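import Mathlib

/-!
# Sahi's functional on a UNION-CLOSED block system is nonnegative — Theorem (U)
# (the combinatorial core of the minimal-multidegree Bernstein positivity of `E_k` for cylinder events)

Support file of the one-cut programme (crux `NoHeavyLowerTail`, stmt-CriticalPhenomena-4575; cell `prim-masterthm`, seat P5 gen 4;
report `P5-LORENTZIAN-TEST.md` §9).  For a finite family `𝒜` of finite sets and a finite set `S`,
`T_𝒜(S) := Σ_{π ∈ Part(S), every block of π in 𝒜} (−1)^{|π|−1} ∏_{B ∈ π} (|B| − 1)!` is Sahi's functional `E_{|S|}` [Sahi 2008,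
eq. (7)] on the `{0,1}`-valued "moment system" `B ↦ [B ∈ 𝒜]` (= `Σ_{σ ∈ Sym(S), all cycle supports in 𝒜} (−1)^{cyc(σ)−1}`; never the
moment system of a probability measure).  Results (all proved, axioms standard):
* `sum_ite_mem_parts` — block bijection "finpartitions of `S` with the block `A`" ↔ "finpartitions of `S ∖ A`";
* **`T_insert`** `T_{𝒜∪{A}}(S) = T_𝒜(S) − (|A|−1)!·T_𝒜(S∖A)` (any family, `A ∉ 𝒜`, `∅ ≠ A ⊆ S`); **`T_peel`** (block of a point);
  **`T_eq_zero_of_not_mem`** (union-closed `𝒜`, `S ∉ 𝒜` ⇒ `T = 0`); **`T_full`** (`𝒜 ⊇ 2^S∖{∅}` ⇒ `T_𝒜(S) = [|S| = 1]`, i.e. `E_n(1,…,1)=0`);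
* **`T_nonneg`** — THEOREM (U): `𝒜` closed under pairwise unions (Mathlib `SupClosed (𝒜 : Set (Finset ι))`), `S ≠ ∅` ⇒ `T_𝒜(S) ≥ 0`
  (add an inclusion-maximal missing set: the family stays union-closed and `T` drops by `(|A|−1)!·T_𝒜(S∖A) ≥ 0`; induct on `|S|` and on
  the number of missing sets down to the full family); **`T_le_factorial`** — `T_𝒜(S) ≤ (|S|−1)!`.
Census behind it: all 1,385,552 union-closed families on ≤ 5 points.  WHY (report §9; bridge to `sahiE` not formalised here): for
CYLINDER events `U_i = {ω ⊇ S_i}` under a product measure, `E_k = Σ_π c_π ∏_e p_e^{n_π(e)}` (`n_π(e)` = #blocks meeting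
`I_e = {i : e ∈ S_i}`) and its Bernstein coefficient at the MINIMAL multidegree `(|I_e|)_e` is `Σ_O T_{𝒜_O}([k])` over `O_e ⊆ I_e`,
`|O_e| = s_e`, with `𝒜_O = {B : ∀ e, B ∩ I_e = ∅ ∨ max(B ∩ I_e) ∈ O_e}` union-closed — so `E_k` of cylinder events is Bernstein-positive
already at the minimal multidegree (identity census-verified, k ≤ 5), refining `…SahiCombCylinder`.  HONEST LABEL: a measure-free
combinatorial theorem; nothing here asserts (M⁺-k) or `C_k` for general increasing events. [this work]
-/

namespace Summit.CriticalPhenomena.PercolationContinuityZ3.Theorems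

namespace SahiUnionClosed

open Finset

variable {ι : Type*} [DecidableEq ι]

/-- Sahi's weight `c_λ` of a block system `P` (Sahi 2008, eq. (6)): `(−1)^{|P|+1} ∏_{B ∈ P} (|B|−1)!` (so the empty system weighs `−1`). [this work] -/
def coefP (P : Finset (Finset ι)) : ℤ :=
  (-1) ^ (P.card + 1) * ∏ B ∈ P, ((B.card - 1).factorial : ℤ)

/-- `T_𝒜(S)`: Sahi's functional summed over the set partitions of `S` all of whose blocks lie in `𝒜`. [this work] -/
def T (𝒜 : Finset (Finset ι)) (S : Finset ι) : ℤ :=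
  ∑ π : Finpartition S, if π.parts ⊆ 𝒜 then coefP π.parts else 0

omit [DecidableEq ι] in
/-- The empty block system weighs `−1`. [folklore] -/
@[simp] theorem coefP_empty : coefP (∅ : Finset (Finset ι)) = -1 := by
  simp [coefP]

/-- Inserting a new block `A` multiplies the weight by `−(|A|−1)!`. [folklore] -/
theorem coefP_insert {A : Finset ι} {P : Finset (Finset ι)} (h : A ∉ P) :
    coefP (insert A P) = -((A.card - 1).factorial : ℤ) * coefP P := by
  simp only [coefP, card_insert_of_notMem h, prod_insert h, pow_succ]
  ring

/-! ### Partitions of `S` with a prescribed block `A` ↔ partitions of `S ∖ A` -/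

omit [DecidableEq ι] in
/-- In a finpartition of `S` containing the block `A`, the other blocks have supremum `S ∖ A`. [folklore] -/
theorem sup_erase_eq_sdiff [DecidableEq ι] {S A : Finset ι} (π : Finpartition S) (hA : A ∈ π.parts) :
    (π.parts.erase A).sup id = S \ A := by
  apply le_antisymm
  · refine Finset.sup_le fun B hB => ?_
    rcases mem_erase.1 hB with ⟨hne, hBp⟩
    exact Finset.subset_sdiff.2 ⟨π.le hBp, π.disjoint hBp hA hne⟩
  · intro x hx
    rcases mem_sdiff.1 hx with ⟨hxS, hxA⟩
    obtain ⟨B, hBp, hxB⟩ := π.exists_mem hxS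
    have hne : B ≠ A := fun h => hxA (h ▸ hxB)
    exact (Finset.le_sup (f := id) (mem_erase.2 ⟨hne, hBp⟩) : B ≤ (π.parts.erase A).sup id) hxB

/-- Drop the block `A` from a finpartition of `S` containing it: a finpartition of `S ∖ A`. [folklore] -/
def dropBlock {S A : Finset ι} (π : Finpartition S) (hA : A ∈ π.parts) : Finpartition (S \ A) :=
  π.ofSubset (erase_subset A π.parts) (sup_erase_eq_sdiff π hA)

/-- The blocks of `dropBlock π hA` are the blocks of `π` other than `A`. [folklore] -/
@[simp] theorem dropBlock_parts {S A : Finset ι} (π : Finpartition S) (hA : A ∈ π.parts) :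
    (dropBlock π hA).parts = π.parts.erase A := rfl

/-- Add the block `A` (nonempty, `A ⊆ S`) to a finpartition of `S ∖ A`: a finpartition of `S`. [folklore] -/
def addBlock {S A : Finset ι} (hA : A.Nonempty) (hAS : A ⊆ S) (π' : Finpartition (S \ A)) : Finpartition S :=
  π'.extend (b := A) (by rw [Finset.bot_eq_empty]; exact hA.ne_empty)
    disjoint_sdiff_self_left (by rw [sup_eq_union, sdiff_union_of_subset hAS])

/-- The blocks of `addBlock hA hAS π'` are `A` and the blocks of `π'`. [folklore] -/
@[simp] theorem addBlock_parts {S A : Finset ι} (hA : A.Nonempty) (hAS : A ⊆ S) (π' : Finpartition (S \ A)) :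
    (addBlock hA hAS π').parts = insert A π'.parts := by
  simp [addBlock]

/-- A block of a finpartition of `S ∖ A` is never `A` (for `A` nonempty). [folklore] -/
theorem not_mem_parts_of_sdiff {S A : Finset ι} (hA : A.Nonempty) (π' : Finpartition (S \ A)) : A ∉ π'.parts := by
  intro h
  obtain ⟨x, hx⟩ := hA
  have hle : A ≤ S \ A := π'.le h
  exact (mem_sdiff.1 (hle hx)).2 hx

/-- **Block bijection.** Summing `g(π ∖ {A})` over the finpartitions `π` of `S` that contain the block `A` is summing `g` over
the finpartitions of `S ∖ A`. [folklore] -/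
theorem sum_ite_mem_parts {S A : Finset ι} (hA : A.Nonempty) (hAS : A ⊆ S) (g : Finset (Finset ι) → ℤ) :
    (∑ π : Finpartition S, if A ∈ π.parts then g (π.parts.erase A) else 0)
      = ∑ π' : Finpartition (S \ A), g π'.parts := by
  rw [← Finset.sum_filter]
  refine Finset.sum_bij' (fun π hπ => dropBlock π (Finset.mem_filter.1 hπ).2)
    (fun π' _ => addBlock hA hAS π') ?_ ?_ ?_ ?_ ?_
  · intro π hπ; exact mem_univ _
  · intro π' _
    exact Finset.mem_filter.2 ⟨mem_univ _, by simp⟩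
  · intro π hπ
    have hA' : A ∈ π.parts := (Finset.mem_filter.1 hπ).2
    ext B
    simp [insert_erase hA']
  · intro π' _
    ext B
    simp [erase_insert (not_mem_parts_of_sdiff hA π')]
  · intro π hπ
    simp

/-- Only blocks inside `S` matter: `T_𝒜(S) = T_{𝒜 ∩ 2^S}(S)`. [folklore] -/
theorem T_filter_subset (𝒜 : Finset (Finset ι)) (S : Finset ι) :
    T 𝒜 S = T (𝒜.filter (· ⊆ S)) S := by
  unfold T
  refine Finset.sum_congr rfl fun π _ => ?_
  have : π.parts ⊆ 𝒜 ↔ π.parts ⊆ 𝒜.filter (· ⊆ S) :=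
    ⟨fun h B hB => Finset.mem_filter.2 ⟨h hB, π.le hB⟩, fun h B hB => (Finset.mem_filter.1 (h hB)).1⟩
  simp only [this]

/-- `T_𝒜(∅) = −1` (the empty partition). [folklore] -/
theorem T_empty (𝒜 : Finset (Finset ι)) : T 𝒜 (∅ : Finset ι) = -1 := by
  unfold T
  have h1 : ∀ π : Finpartition (∅ : Finset ι), π.parts = ∅ := fun π =>
    (Finpartition.parts_eq_empty_iff).2 rfl
  have : (Finset.univ : Finset (Finpartition (∅ : Finset ι))) = {(Finpartition.empty _ : Finpartition (⊥ : Finset ι))} := by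
    apply Finset.eq_singleton_iff_unique_mem.2
    refine ⟨mem_univ _, fun π _ => ?_⟩
    ext B; simp [h1 π, Finpartition.empty]
  rw [this, Finset.sum_singleton]
  simp [Finpartition.empty]

/-- **Adding a block to the family.** For `A ∉ 𝒜`, `∅ ≠ A ⊊ S`:
`T_{𝒜 ∪ {A}}(S) = T_𝒜(S) − (|A|−1)!·T_𝒜(S ∖ A)`. [this work] -/
theorem T_insert {𝒜 : Finset (Finset ι)} {A S : Finset ι} (hA𝒜 : A ∉ 𝒜) (hA : A.Nonempty) (hAS : A ⊆ S) :
    T (insert A 𝒜) S = T 𝒜 S - ((A.card - 1).factorial : ℤ) * T 𝒜 (S \ A) := by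
  set w : ℤ := ((A.card - 1).factorial : ℤ) with hw
  set g : Finset (Finset ι) → ℤ := fun P => if P ⊆ 𝒜 then -w * coefP P else 0 with hg
  have key : ∀ π : Finpartition S,
      (if π.parts ⊆ insert A 𝒜 then coefP π.parts else 0)
        = (if π.parts ⊆ 𝒜 then coefP π.parts else 0) + (if A ∈ π.parts then g (π.parts.erase A) else 0) := by
    intro π
    simp only [Finset.subset_insert_iff]
    by_cases hAπ : A ∈ π.parts
    · have hnot : ¬ π.parts ⊆ 𝒜 := fun h => hA𝒜 (h hAπ)
      simp only [hAπ, if_true, hnot, if_false, zero_add, hg]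
      by_cases hsub : π.parts.erase A ⊆ 𝒜
      · rw [if_pos hsub, if_pos hsub]
        conv_lhs => rw [← insert_erase hAπ]
        rw [coefP_insert (notMem_erase A π.parts), hw]
      · rw [if_neg hsub, if_neg hsub]
    · simp only [hAπ, if_false, add_zero, erase_eq_of_notMem hAπ]
  have h1 : T (insert A 𝒜) S = T 𝒜 S + ∑ π : Finpartition S, (if A ∈ π.parts then g (π.parts.erase A) else 0) := by
    unfold T; rw [← Finset.sum_add_distrib]; exact Finset.sum_congr rfl fun π _ => key π
  have h3 : (∑ π' : Finpartition (S \ A), g π'.parts) = -w * T 𝒜 (S \ A) := by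
    unfold T; rw [Finset.mul_sum]
    refine Finset.sum_congr rfl fun π' _ => ?_
    simp only [hg]; split_ifs <;> ring
  rw [h1, sum_ite_mem_parts hA hAS g, h3]
  ring

/-- **Union-closed families: `T` vanishes off the family.** If `𝒜` is union-closed and `S ∉ 𝒜` is nonempty then no partition of
`S` has all its blocks in `𝒜`, so `T_𝒜(S) = 0`. [this work] -/
theorem T_eq_zero_of_not_mem {𝒜 : Finset (Finset ι)} (h𝒜 : SupClosed (𝒜 : Set (Finset ι))) {S : Finset ι}
    (hS : S.Nonempty) (hS𝒜 : S ∉ 𝒜) : T 𝒜 S = 0 := by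
  unfold T
  refine Finset.sum_eq_zero fun π _ => ?_
  rw [if_neg]
  intro hsub
  have hne : π.parts.Nonempty := π.parts_nonempty (by rw [Finset.bot_eq_empty]; exact hS.ne_empty)
  have hmem : π.parts.sup' hne id ∈ (↑𝒜 : Set (Finset ι)) :=
    Finset.sup'_mem (↑𝒜 : Set (Finset ι)) (fun A hA B hB => h𝒜 hA hB) π.parts hne id (fun B hB => hsub hB)
  rw [Finset.sup'_eq_sup, π.sup_parts] at hmem
  exact hS𝒜 hmem

/-- **Peeling the block of a point.** For `x ∈ S`: `T_𝒜(S) = Σ_{x ∈ B ⊆ S, B ∈ 𝒜} −(|B|−1)!·T_𝒜(S ∖ B)` (with `T_𝒜(∅) = −1`, the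
term `B = S` contributes `(|S|−1)!`). [this work] -/
theorem T_peel (𝒜 : Finset (Finset ι)) {S : Finset ι} {x : ι} (hx : x ∈ S) :
    T 𝒜 S = ∑ B ∈ S.powerset.filter (fun B => x ∈ B),
      (if B ∈ 𝒜 then -((B.card - 1).factorial : ℤ) * T 𝒜 (S \ B) else 0) := by
  set Pf := S.powerset.filter (fun B => x ∈ B) with hPf
  set F : Finpartition S → ℤ := fun π => if π.parts ⊆ 𝒜 then coefP π.parts else 0 with hF
  have step1 : ∀ π : Finpartition S, F π = ∑ B ∈ Pf, (if B ∈ π.parts then F π else 0) := by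
    intro π
    obtain ⟨B₀, hB₀, hxB₀⟩ := π.exists_mem hx
    have hint : Pf ∩ π.parts = {B₀} := by
      apply Finset.eq_singleton_iff_unique_mem.2
      refine ⟨mem_inter.2 ⟨Finset.mem_filter.2 ⟨mem_powerset.2 (π.le hB₀), hxB₀⟩, hB₀⟩, fun B hB => ?_⟩
      rcases mem_inter.1 hB with ⟨hB1, hB2⟩
      exact π.eq_of_mem_parts hB2 hB₀ (Finset.mem_filter.1 hB1).2 hxB₀
    rw [Finset.sum_ite_mem, hint, sum_singleton]
  have step2 : ∀ B ∈ Pf, (∑ π : Finpartition S, (if B ∈ π.parts then F π else 0))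
      = (if B ∈ 𝒜 then -((B.card - 1).factorial : ℤ) * T 𝒜 (S \ B) else 0) := by
    intro B hB
    have hBS : B ⊆ S := mem_powerset.1 (Finset.mem_filter.1 hB).1
    have hBne : B.Nonempty := ⟨x, (Finset.mem_filter.1 hB).2⟩
    set g : Finset (Finset ι) → ℤ :=
      fun P => if B ∈ 𝒜 ∧ P ⊆ 𝒜 then -((B.card - 1).factorial : ℤ) * coefP P else 0 with hg
    have hrw : ∀ π : Finpartition S, (if B ∈ π.parts then F π else 0) = (if B ∈ π.parts then g (π.parts.erase B) else 0) := by
      intro π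
      by_cases hBπ : B ∈ π.parts
      · have hiff : π.parts ⊆ 𝒜 ↔ B ∈ 𝒜 ∧ π.parts.erase B ⊆ 𝒜 := by
          conv_lhs => rw [← insert_erase hBπ]
          exact Finset.insert_subset_iff
        simp only [hBπ, if_true, hF, hg, hiff]
        by_cases hsub : B ∈ 𝒜 ∧ π.parts.erase B ⊆ 𝒜
        · rw [if_pos hsub, if_pos hsub]
          conv_lhs => rw [← insert_erase hBπ]
          rw [coefP_insert (notMem_erase B π.parts)]
        · rw [if_neg hsub, if_neg hsub]
      · simp only [hBπ, if_false]
    rw [Finset.sum_congr rfl fun π _ => hrw π, sum_ite_mem_parts hBne hBS g]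
    by_cases hB𝒜 : B ∈ 𝒜
    · rw [if_pos hB𝒜]
      unfold T
      rw [Finset.mul_sum]
      refine Finset.sum_congr rfl fun π' _ => ?_
      simp only [hg, hB𝒜, true_and]
      split_ifs <;> ring
    · rw [if_neg hB𝒜]
      refine Finset.sum_eq_zero fun π' _ => ?_
      simp [hg, hB𝒜]
  unfold T
  rw [show (∑ π : Finpartition S, if π.parts ⊆ 𝒜 then coefP π.parts else 0) = ∑ π : Finpartition S, F π from rfl]
  rw [Finset.sum_congr rfl fun π _ => step1 π, Finset.sum_comm]
  exact Finset.sum_congr rfl step2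

/-- Re-indexing the peel by complements: `Σ_{x ∈ B ⊆ S} f(B) = Σ_{C ⊆ S ∖ {x}} f(S ∖ C)`. [folklore] -/
theorem sum_filter_mem_eq_sum_powerset_erase {S : Finset ι} {x : ι} (hx : x ∈ S) (f : Finset ι → ℤ) :
    ∑ B ∈ S.powerset.filter (fun B => x ∈ B), f B = ∑ C ∈ (S.erase x).powerset, f (S \ C) := by
  refine Finset.sum_bij' (fun B _ => S \ B) (fun C _ => S \ C) ?_ ?_ ?_ ?_ ?_
  · intro B hB
    rw [mem_powerset]
    intro y hy
    rcases mem_sdiff.1 hy with ⟨hyS, hyB⟩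
    exact mem_erase.2 ⟨fun h => hyB (h ▸ (Finset.mem_filter.1 hB).2), hyS⟩
  · intro C hC
    have hCS : C ⊆ S := (mem_powerset.1 hC).trans (erase_subset x S)
    refine Finset.mem_filter.2 ⟨mem_powerset.2 sdiff_subset, mem_sdiff.2 ⟨hx, fun hxC => ?_⟩⟩
    exact (mem_erase.1 (mem_powerset.1 hC hxC)).1 rfl
  · intro B hB
    exact Finset.sdiff_sdiff_eq_self (mem_powerset.1 (Finset.mem_filter.1 hB).1)
  · intro C hC
    exact Finset.sdiff_sdiff_eq_self ((mem_powerset.1 hC).trans (erase_subset x S))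
  · intro B hB
    rw [Finset.sdiff_sdiff_eq_self (mem_powerset.1 (Finset.mem_filter.1 hB).1)]

/-- **The full family.** If every nonempty subset of `S` lies in `𝒜` then `T_𝒜(S) = [|S| = 1]` for nonempty `S` — Sahi's
`E_n(1,…,1) = 0` for `n ≥ 2` in this language. [this work] -/
theorem T_full : ∀ (n : ℕ) (𝒜 : Finset (Finset ι)) (S : Finset ι), S.card = n →
    (∀ B, B ⊆ S → B.Nonempty → B ∈ 𝒜) → S.Nonempty → T 𝒜 S = if S.card = 1 then 1 else 0 := by
  intro n
  induction n using Nat.strong_induction_on with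
  | _ n ih =>
    intro 𝒜 S hSn hfull hS
    obtain ⟨x, hx⟩ := hS
    rw [T_peel 𝒜 hx, Finset.sum_congr rfl fun B hB =>
      if_pos (hfull B (mem_powerset.1 (Finset.mem_filter.1 hB).1) ⟨x, (Finset.mem_filter.1 hB).2⟩),
      sum_filter_mem_eq_sum_powerset_erase hx, ← Finset.add_sum_erase _ _ (mem_powerset.2 (empty_subset (S.erase x))),
      sdiff_empty, Finset.sdiff_self, T_empty]
    -- remaining terms: `C` nonempty, `T_𝒜(C) = [|C| = 1]` by induction
    have hrest : ∀ C ∈ ((S.erase x).powerset).erase ∅,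
        -(((S \ C).card - 1).factorial : ℤ) * T 𝒜 (S \ (S \ C))
          = if C.card = 1 then -((S.card - 2).factorial : ℤ) else 0 := by
      intro C hC
      rcases mem_erase.1 hC with ⟨hCne, hCpow⟩
      have hCsub : C ⊆ S.erase x := mem_powerset.1 hCpow
      have hCS : C ⊆ S := hCsub.trans (erase_subset x S)
      have hCne' : C.Nonempty := nonempty_iff_ne_empty.2 hCne
      have hClt : C.card < n := by
        rw [← hSn]
        exact lt_of_le_of_lt (card_le_card hCsub) (card_erase_lt_of_mem hx)
      rw [Finset.sdiff_sdiff_eq_self hCS, ih C.card hClt 𝒜 C rfl (fun B hB hBne => hfull B (hB.trans hCS) hBne) hCne']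
      by_cases hC1 : C.card = 1
      · rw [if_pos hC1, if_pos hC1, mul_one, card_sdiff_of_subset hCS, hC1]
        rw [show S.card - 1 - 1 = S.card - 2 by omega]
      · rw [if_neg hC1, if_neg hC1, mul_zero]
    rw [Finset.sum_congr rfl hrest, Finset.sum_ite, Finset.sum_const_zero, add_zero, Finset.sum_const, nsmul_eq_mul]
    have hcount : (((S.erase x).powerset.erase ∅).filter (fun C => C.card = 1)).card = S.card - 1 := by
      rw [Finset.filter_erase, erase_eq_of_notMem (by simp), ← Finset.powersetCard_eq_filter, card_powersetCard,
        card_erase_of_mem hx, Nat.choose_one_right]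
    rw [hcount]
    -- arithmetic: (|S|-1)! - (|S|-1)·(|S|-2)! = [|S| = 1]
    have hSpos : 1 ≤ S.card := card_pos.2 ⟨x, hx⟩
    by_cases hS1 : S.card = 1
    · rw [if_pos hS1, hS1]; norm_num
    · rw [if_neg hS1]
      obtain ⟨m, hm⟩ : ∃ m, S.card = m + 2 := ⟨S.card - 2, by omega⟩
      rw [hm]
      simp only [Nat.add_sub_cancel, show m + 2 - 1 = m + 1 by omega, Nat.factorial_succ]
      push_cast
      ring

/-- Restricting a union-closed family to the subsets of `S` keeps it union-closed. [folklore] -/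
theorem supClosed_filter_subset {𝒜 : Finset (Finset ι)} (h𝒜 : SupClosed (𝒜 : Set (Finset ι))) (S : Finset ι) :
    SupClosed (↑(𝒜.filter (· ⊆ S)) : Set (Finset ι)) := by
  intro B hB C hC
  rw [Finset.coe_filter, Set.mem_setOf_eq] at hB hC ⊢
  exact ⟨h𝒜 hB.1 hC.1, union_subset hB.2 hC.2⟩

/-- Main induction: `T_𝒜(S) ≥ 0` for union-closed `𝒜` (restricted to subsets of `S`), by induction on `|S|` and, inside, on the
number of nonempty subsets of `S` missing from `𝒜` (adding a maximal one keeps union-closure and lowers `T`). [this work] -/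
theorem T_nonneg_aux : ∀ (n : ℕ) (S : Finset ι), S.card = n → ∀ (m : ℕ) (𝒜 : Finset (Finset ι)),
    ((S.powerset.erase ∅) \ 𝒜).card = m → SupClosed (𝒜 : Set (Finset ι)) → (∀ B ∈ 𝒜, B ⊆ S) → S.Nonempty →
    0 ≤ T 𝒜 S := by
  intro n
  induction n using Nat.strong_induction_on with
  | _ n ihn =>
    intro S hSn m
    induction m using Nat.strong_induction_on with
    | _ m ihm =>
      intro 𝒜 hm h𝒜 h𝒜S hS
      by_cases hS𝒜 : S ∈ 𝒜
      swap
      · rw [T_eq_zero_of_not_mem h𝒜 hS hS𝒜]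
      by_cases hm0 : ((S.powerset.erase ∅) \ 𝒜) = ∅
      · -- full family
        have hfull : ∀ B, B ⊆ S → B.Nonempty → B ∈ 𝒜 := fun B hBS hBne => by_contra fun hB =>
          Finset.eq_empty_iff_forall_notMem.1 hm0 B (mem_sdiff.2 ⟨mem_erase.2 ⟨hBne.ne_empty, mem_powerset.2 hBS⟩, hB⟩)
        rw [T_full n 𝒜 S hSn hfull hS]
        split_ifs <;> norm_num
      · -- pick a missing set `A` of maximal cardinality; it is inclusion-maximal, so `insert A 𝒜` stays union-closed
        obtain ⟨A, hAmem, hAmax⟩ := exists_max_image _ Finset.card (nonempty_iff_ne_empty.2 hm0)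
        rcases mem_sdiff.1 hAmem with ⟨hA1, hA𝒜⟩
        rcases mem_erase.1 hA1 with ⟨hAne, hApow⟩
        have hAS : A ⊆ S := mem_powerset.1 hApow
        have hAne' : A.Nonempty := nonempty_iff_ne_empty.2 hAne
        have hAneS : A ≠ S := fun h => hA𝒜 (h ▸ hS𝒜)
        have hmax' : ∀ C, A ⊆ C → C ⊆ S → C ∈ insert A 𝒜 := fun C hAC hCS => by
          by_cases hCA : C = A
          · exact hCA ▸ mem_insert_self _ _
          · refine mem_insert_of_mem (by_contra fun hC => ?_)
            have h1 := hAmax C (mem_sdiff.2 ⟨mem_erase.2 ⟨(hAne'.mono hAC).ne_empty, mem_powerset.2 hCS⟩, hC⟩)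
            exact absurd (card_lt_card (lt_of_le_of_ne hAC (Ne.symm hCA))) (not_lt.2 h1)
        have hAS' : ∀ B ∈ insert A 𝒜, B ⊆ S := fun B hB => by
          rcases mem_insert.1 hB with rfl | hB'
          exacts [hAS, h𝒜S B hB']
        have hUC : SupClosed (↑(insert A 𝒜) : Set (Finset ι)) := by
          intro B hB C hC
          rw [Finset.mem_coe] at hB hC ⊢
          have hBCS : B ∪ C ⊆ S := union_subset (hAS' B hB) (hAS' C hC)
          rcases mem_insert.1 hB with rfl | hB'
          · exact hmax' _ subset_union_left hBCS
          rcases mem_insert.1 hC with rfl | hC'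
          · exact hmax' _ subset_union_right hBCS
          exact mem_insert_of_mem (h𝒜 hB' hC')
        -- the new family misses fewer sets: inner induction
        have hlt : ((S.powerset.erase ∅) \ insert A 𝒜).card < m := by
          rw [← hm]
          refine card_lt_card ⟨sdiff_subset_sdiff subset_rfl (subset_insert _ _), fun h => ?_⟩
          exact (mem_sdiff.1 (h hAmem)).2 (mem_insert_self _ _)
        have hbig : 0 ≤ T (insert A 𝒜) S := ihm _ hlt (insert A 𝒜) rfl hUC hAS' hS
        -- the smaller ground set `S \ A`: outer induction
        have hsmall : 0 ≤ T 𝒜 (S \ A) := by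
          rw [T_filter_subset]
          refine ihn (S \ A).card (by rw [← hSn]; exact card_lt_card (sdiff_ssubset hAS hAne')) (S \ A) rfl _
            (𝒜.filter (· ⊆ S \ A)) rfl (supClosed_filter_subset h𝒜 _) (fun B hB => (Finset.mem_filter.1 hB).2) ?_
          exact Finset.sdiff_nonempty.2 fun h => hAneS (subset_antisymm hAS h)
        rw [show T 𝒜 S = T (insert A 𝒜) S + ((A.card - 1).factorial : ℤ) * T 𝒜 (S \ A) by
          rw [T_insert hA𝒜 hAne' hAS]; ring]
        exact add_nonneg hbig (mul_nonneg (by positivity) hsmall)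

/-- **Theorem (U).** For a union-closed family `𝒜` of finite sets and a nonempty finite set `S`, Sahi's functional of the block
system is nonnegative: `T_𝒜(S) = Σ_{π ∈ Part(S), blocks in 𝒜} (−1)^{|π|−1} ∏_{B∈π} (|B|−1)! ≥ 0`. [this work] -/
theorem T_nonneg {𝒜 : Finset (Finset ι)} (h𝒜 : SupClosed (𝒜 : Set (Finset ι))) {S : Finset ι} (hS : S.Nonempty) :
    0 ≤ T 𝒜 S := by
  rw [T_filter_subset]
  exact T_nonneg_aux S.card S rfl _ (𝒜.filter (· ⊆ S)) rfl (supClosed_filter_subset h𝒜 S)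
    (fun B hB => (Finset.mem_filter.1 hB).2) hS

/-- … and it is at most `(|S|−1)!` (the value for `𝒜 = {S}`). [this work] -/
theorem T_le_factorial {𝒜 : Finset (Finset ι)} (h𝒜 : SupClosed (𝒜 : Set (Finset ι))) {S : Finset ι} (hS : S.Nonempty) :
    T 𝒜 S ≤ ((S.card - 1).factorial : ℤ) := by
  obtain ⟨x, hx⟩ := hS
  rw [T_peel 𝒜 hx]
  have hSmem : S ∈ S.powerset.filter (fun B => x ∈ B) := Finset.mem_filter.2 ⟨mem_powerset.2 subset_rfl, hx⟩
  rw [← Finset.add_sum_erase _ _ hSmem, Finset.sdiff_self, T_empty]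
  have hrest : (∑ B ∈ (S.powerset.filter (fun B => x ∈ B)).erase S,
      (if B ∈ 𝒜 then -((B.card - 1).factorial : ℤ) * T 𝒜 (S \ B) else 0)) ≤ 0 := by
    refine Finset.sum_nonpos fun B hB => ?_
    rcases mem_erase.1 hB with ⟨hBS, hB'⟩
    have hBsub : B ⊆ S := mem_powerset.1 (Finset.mem_filter.1 hB').1
    split_ifs with hB𝒜
    · have hne : (S \ B).Nonempty := Finset.sdiff_nonempty.2 fun h => hBS (subset_antisymm hBsub h)
      have := T_nonneg h𝒜 hne
      nlinarith [show (0 : ℤ) ≤ ((B.card - 1).factorial : ℤ) by positivity]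
    · exact le_rfl
  have hfirst : (if S ∈ 𝒜 then -((S.card - 1).factorial : ℤ) * (-1) else 0) ≤ ((S.card - 1).factorial : ℤ) := by
    split_ifs
    · simp
    · positivity
  linarith
end SahiUnionClosed

end Summit.CriticalPhenomena.PercolationContinuityZ3.Theorems
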